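import Summits.QuantumFields.YangMills.Statement
import Summits.QuantumFields.YangMills.Theses.LangevinControlUV
import Summits.QuantumFields.YangMills.Theorems.LangevinControlUVGapToContinuumCommensurableTransfer
import Summits.QuantumFields.YangMills.Theorems.LangevinControlUVGapToContinuumOneLegSmearedField
import Summits.QuantumFields.YangMills.Theorems.LangevinControlUVGapToContinuumZeroCoupling
import HarnessLib

/-!
# `Lines/OneLegTame_special.lean` — F3 / BC5 witness for the rung `OneLegTame` (standalone twin)

Unit `fwd-ladder-QuantumFields-50` (G4 ladder-down on crux `GapToContinuum`, stmt-QuantumFields-8896).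
The canonical witness theorems are compiled inside `Lines/OneLegTame.lean` §Witness
(`OneLegTameLine.oneLegTame_onUniformSlabClustering` = floor A, R7 p127790;
`OneLegTameLine.oneLegTame_onZeroCouplingStratum` = floor B, p141172).  Because the farm had no olean for
the freshly committed module `…Cruxes.GapToContinuum.Lines.OneLegTame` at filing time, this file does not
import it: it carries TEXTUALLY IDENTICAL copies of `OneLegSector`, `IsTameScheme`, `OneLegTame`,
`TameGapToContinuum` in the scratch namespace `…OneLegTameProbe` and proves the same two floor
specialisations + the closing `example` — no `sorry`.  Witness regime: S (`YangMills`) is NOT known in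
either floor regime (both floors are conditional transfers about a given continuum limit).
-/

open scoped SchwartzMap Topology ComplexConjugate ComplexOrder
open Filter Set MeasureTheory
open Literature.MathematicalPhysics.AQFT Literature.MathematicalPhysics.QuantumLattice
open Literature.MathematicalPhysics.QuantumFieldTheory
open Summit.QuantumFields.YangMills.Cruxes.LatticeGapOnTrajectory.OrbitKantorovichFiniteSize
open Summit.QuantumFields.YangMills.Cruxes.LatticeGapOnTrajectory.OrbitKantorovichFiniteSize.Transfer

noncomputable section

namespace Summit.QuantumFields.YangMills.Cruxes.GapToContinuum.OneLegTameProbe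

/-- **The `(1,1)` sector of `T.HasMassGap Δ`**: one leg on each side, every species pair, every
time-ordered Schwartz test function, free constant (verbatim `OSData.HasMassGap` at `n = m = 1`;
same text as the census's `OneLegGap`, `Cruxes/GapToContinuum/StrategyCensus.lean`). -/
def OneLegSector {ι : Type} (T : OSData ι 4) (Δ : ℝ) : Prop :=
  ∀ (k k' : Fin 1 → ι) (F G : 𝓢((Fin 1 → EuclideanSpace ℝ (Fin 4)), ℂ)),
    IsTimeOrdered F → IsTimeOrdered G →
      ∃ C : ℝ, ∀ t : ℝ, 0 ≤ t →
        ∀ H : 𝓢((Fin (1 + 1) → EuclideanSpace ℝ (Fin 4)), ℂ),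
          IsAppendTensorOf H (osAdjoint F) (translateMulti (EuclideanSpace.single 0 t) G) →
            ‖T.schwinger (1 + 1) (Fin.append (k ∘ Fin.rev) k') H -
                T.schwinger 1 (k ∘ Fin.rev) (osAdjoint F) * T.schwinger 1 k' G‖ ≤
              C * Real.exp (-Δ * t)

/-- The full gap contains its `(1,1)` sector. -/
theorem oneLegSector_of_hasMassGap {ι : Type} (T : OSData ι 4) (Δ : ℝ) (h : T.HasMassGap Δ) :
    OneLegSector T Δ :=
  fun k k' F G hF hG => h 1 1 k k' F G hF hG

/-- **Tame schemes** — exactly the hypothesis list of the landed R7 transfer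
`gapToContinuum_commensurableTransfer` (p127790): spacings eventually commensurable with one physical
length `t₀ > 0`; `0 ≤ β_k` eventually (odd-torus reflection positivity, defect D1); physical volume
beating `log a_k⁻¹` (Hankel-chain depth, defect D3b); reflection-symmetric, polynomially bounded
renormalisations (limits of reflected representatives; `log |c_s(k)| = O(log a_k⁻¹)`). -/
def IsTameScheme {G : Type} [Group G] [MeasurableSpace G] [MeasurableInv G]
    (sch : SpeciesScheme (YMSpecies G)) : Prop :=
  (∃ t₀ : ℝ, 0 < t₀ ∧ ∀ᶠ k in atTop, ∃ m : ℕ, sch.a k * m = t₀) ∧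
  (∀ᶠ k in atTop, 0 ≤ sch.β k) ∧
  Tendsto (fun k => sch.a k * sch.L k / Real.log (sch.a k)⁻¹) atTop atTop ∧
  sch.IsReflectionSymmetric ∧
  (∀ s, ∃ (q : ℕ) (K : ℝ), ∀ k,
    |sch.c s k| ≤ K * ((sch.a k)⁻¹) ^ q ∧ |sch.m s k| ≤ K * ((sch.a k)⁻¹) ^ q)

/-- **THE RUNG `OneLegTame`** (`rung_decl`): the crux `GapToContinuum` with its conclusion restricted
to the `(1,1)` sector and its scheme restricted to the tame class — SAME per-pair antecedent
`HasLatticeMassGap r sch Δ`, same `IsYangMillsFor`, same rate. -/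
def OneLegTame : Prop :=
  ∀ (G : Type) [Group G] [TopologicalSpace G] [IsTopologicalGroup G] [CompactSpace G]
    [MeasurableSpace G] [BorelSpace G] (r : LatticeRep G) (sch : SpeciesScheme (YMSpecies G))
    (T : OSData (YMSpecies G) 4) (Δ : ℝ), 0 < Δ → IsTameScheme sch →
      IsYangMillsFor r sch T → HasLatticeMassGap r sch Δ → OneLegSector T Δ

/-- **The next rung up (all sectors, tame schemes)** — named distance only: the crux restricted to
tame schemes.  Open; the multi-leg defect D2 lives exactly between `OneLegTame` and this. -/
def TameGapToContinuum : Prop :=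
  ∀ (G : Type) [Group G] [TopologicalSpace G] [IsTopologicalGroup G] [CompactSpace G]
    [MeasurableSpace G] [BorelSpace G] (r : LatticeRep G) (sch : SpeciesScheme (YMSpecies G))
    (T : OSData (YMSpecies G) 4) (Δ : ℝ), 0 < Δ → IsTameScheme sch →
      IsYangMillsFor r sch T → HasLatticeMassGap r sch Δ → T.HasMassGap Δ

/-- On-path certificate (top → rung): the crux gives the rung by restriction. -/
theorem oneLegTame_of_gapToContinuum
    (h : Summit.QuantumFields.YangMills.Theses.LangevinControlUV.GapToContinuum) : OneLegTame :=
  fun G _ _ _ _ _ _ r sch T Δ hΔ _ hYM hlat =>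
    oneLegSector_of_hasMassGap T Δ (h G r sch T Δ hΔ hYM hlat)

/-- Top → middle rung, by restriction. -/
theorem tameGapToContinuum_of_gapToContinuum
    (h : Summit.QuantumFields.YangMills.Theses.LangevinControlUV.GapToContinuum) : TameGapToContinuum :=
  fun G _ _ _ _ _ _ r sch T Δ hΔ _ hYM hlat => h G r sch T Δ hΔ hYM hlat

/-- Middle rung → rung, by restriction to the `(1,1)` sector. -/
theorem oneLegTame_of_tameGapToContinuum (h : TameGapToContinuum) : OneLegTame :=
  fun G _ _ _ _ _ _ r sch T Δ hΔ htame hYM hlat =>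
    oneLegSector_of_hasMassGap T Δ (h G r sch T Δ hΔ htame hYM hlat)


/-- **Floor B**: the rung on the zero-coupling stratum (p141172). -/
theorem oneLegTame_onZeroCouplingStratum :
    ∀ (G : Type) [Group G] [TopologicalSpace G] [IsTopologicalGroup G] [CompactSpace G]
      [MeasurableSpace G] [BorelSpace G] (r : LatticeRep G) (sch : SpeciesScheme (YMSpecies G))
      (T : OSData (YMSpecies G) 4) (Δ : ℝ), (∀ᶠ k in atTop, sch.β k = 0) → 0 < Δ → IsTameScheme sch →
        IsYangMillsFor r sch T → HasLatticeMassGap r sch Δ → OneLegSector T Δ :=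
  fun G _ _ _ _ _ _ r sch T Δ hβ hΔ _ hYM hlat =>
    oneLegSector_of_hasMassGap T Δ
      (Summit.QuantumFields.YangMills.Theorems.GapToContinuum.ZeroCoupling.gapToContinuum_on_zeroCouplingStratum
        G r sch T Δ hβ hΔ hYM hlat)

/-- **Floor A**: the rung under R7's extra pair-uniform slab clustering (p127790). -/
theorem oneLegTame_onUniformSlabClustering :
    ∀ (G : Type) [Group G] [TopologicalSpace G] [IsTopologicalGroup G] [CompactSpace G]
      [MeasurableSpace G] [BorelSpace G] (r : LatticeRep G) (sch : SpeciesScheme (YMSpecies G))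
      (T : OSData (YMSpecies G) 4) (Δ : ℝ), 0 < Δ → IsTameScheme sch →
        IsYangMillsFor r sch T → HasLatticeMassGap r sch Δ →
        (∃ (p : ℕ) (K : ℝ), 0 ≤ K ∧ ∀ᶠ k in atTop,
          ∀ (w N : ℕ) (X : GaugeConfig 4 (sch.side k) G → ℂ) (B : ℝ), Measurable X →
            (∀ U, ‖X U‖ ≤ B) →
            DependsOn X {e : Edge 4 (sch.side k) | 1 ≤ (e.1 0).val ∧ (e.1 0).val ≤ w} →
            N + 2 * w ≤ sch.L k →
              ‖osCorr (wilsonMeasure r.ρ (sch.β k)) GaugeConfig.negReflect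
                  (torusTimeShift (sch.side k) N) X X‖ ≤
                K * ((sch.a k)⁻¹ * ((w : ℝ) + 1) * ((sch.L k : ℝ) + 1)) ^ p * B ^ 2 *
                  Real.exp (-Δ * sch.a k * N)) →
        OneLegSector T Δ := by
  intro G _ _ _ _ _ _ r sch T Δ hΔ htame hYM _ hclust
  obtain ⟨hcomm, hβ, hvol, hsym, hpoly⟩ := htame
  exact oneLegSector_of_hasMassGap T Δ
    (Summit.QuantumFields.YangMills.Theorems.GapToContinuum.SlabTransfer.gapToContinuum_commensurableTransfer
      G r sch T Δ hΔ hcomm hβ hvol hsym hpoly hYM hclust)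

/-- The rung's statement with floor B's clause, as a closed `example` (F3 shape). -/
example : ∀ (G : Type) [Group G] [TopologicalSpace G] [IsTopologicalGroup G] [CompactSpace G]
      [MeasurableSpace G] [BorelSpace G] (r : LatticeRep G) (sch : SpeciesScheme (YMSpecies G))
      (T : OSData (YMSpecies G) 4) (Δ : ℝ), (∀ᶠ k in atTop, sch.β k = 0) → 0 < Δ → IsTameScheme sch →
        IsYangMillsFor r sch T → HasLatticeMassGap r sch Δ → OneLegSector T Δ :=
  oneLegTame_onZeroCouplingStratum


end Summit.QuantumFields.YangMills.Cruxes.GapToContinuum.OneLegTameProbe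

end
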